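import Mathlib
import HarnessLib
import Summits.HubbardSuperconductivity.HubbardSuperconductivity.Theorems.ChiralWindowDefsEx
import Summits.HubbardSuperconductivity.HubbardSuperconductivity.Theorems.ChiralWindowCwKLChiralWindowChannelBoundX
import Summits.HubbardSuperconductivity.HubbardSuperconductivity.Theorems.ChiralWindowCwKLChiralWindowBlockBoundsR
import Summits.HubbardSuperconductivity.HubbardSuperconductivity.Theorems.ChiralWindowCwKLChiralWindowBlockBoundsXTrig

/-!
# Crux `CwKLChiralWindow` (stmt-1741), line `Sketch`: block-level Ritz/Temple/far-channel bounds, `E_x`-block form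

`stub_klBlockBoundsX`: the `E_x`-block variant of `stub_klBlockBoundsR`
(`Theorems/ChiralWindowCwKLChiralWindowBlockBoundsR.lean`).  For a channel block `b : KLBlock` of the certificate record with
its residual-form enclosures `b.EnclosureR tab μ χ` at a level `μ ∈ (-4,0)`, the rational bounds of the `E_x`-form checker
(`Theorems/ChiralWindowDefsEx.lean`: `templeOKX`, `lowerOKX`, `lowerX`) are sound: if `b.lowerOKX tab χ` then
`b.lowerX tab χ ≤ channelInf ε₀ μ 1 χ`, and if `b.templeOKX tab χ` in the equality case `withU ∨ χ ≠ A1g` then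
`channelInf ε₀ μ 1 χ ≤ b.upper`.

* Off the doublet (`χ ≠ E`) the `E_x`-form tests ARE the residual-form tests (`klX_templeOKX_of_ne`) and everything is
  `kl_bkbr_temple` / `kl_bkb_far`.
* For `χ = E` with `templeOKX` the record is unpacked exactly as in the residual form (`kl_bkb_arith`, `kl_bkb_defl_nonneg`,
  `kl_bkb_deflKernel_eq`, `klS_sectorKernel_eq`; `ritzOK … E` forces `withU = false`, so the kernel is the plain `χ₀(k+k')`)
  and the landed abstract `E_x`-block bound `stub_klChannelBoundX` (simple bottom on the reflection-even block, square mass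
  `Hhi/2`) is instantiated with `Φ = b.trialFun tab`, `ρlo = rholo`, `ρhi = rhohi`, `et = etil`, `h = Hhi`, `β = beta`, `s = s`;
  its two symmetry hypotheses are the content of `…BlockBoundsXTrig.lean`: the cosine-only trial is reflection-even
  (`kl_bkbx_trialFun_refl`) and the quarter-turn-paired deflation kernel is rotation invariant (`kl_bkbx_deflKernel_rot`).
* On a block without trial the far-channel bound `kl_bkb_far` applies verbatim.
-/

noncomputable section

set_option linter.dupNamespace false

namespace Summit.HubbardSuperconductivity.HubbardSuperconductivity.Theorems

open MeasureTheory Literature.MathematicalPhysics.QuantumLattice CwKLChiralWindow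

/-! ### Dictionary: the Ritz Booleans -/

/-- What `ritzOK` says: the trial is used and fits the channel, `0 < Nlo`, `Qhi < 0`, and `withU` only for `A1g`.
[folklore] -/
theorem kl_bkbx_ritz {b : KLBlock} {tab : List KLTrig} {χ : D4Irrep} (h : b.ritzOK tab χ = true) :
    b.useTrial = true ∧ (klTab tab b.trial).fits χ = true ∧ 0 < b.Nlo ∧ b.Qhi < 0 ∧
      (b.withU = true → χ = D4Irrep.A1g) := by
  simp only [KLBlock.ritzOK, Bool.and_eq_true, decide_eq_true_eq] at h
  obtain ⟨⟨⟨⟨⟨⟨⟨hut, -⟩, hfits⟩, hNlo⟩, -⟩, -⟩, hQhi⟩, hwu⟩ := h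
  exact ⟨hut, hfits, hNlo, hQhi, kl_bkb_withU hwu⟩

/-! ### The `E_x`-block Temple bound, instantiated with the block data -/

/-- **Temple/Ritz bounds of the `E` block, `E_x` form.** If the checker accepts the `E_x`-form Temple data of the block
(`templeOKX … E`: Ritz data with a cosine-only trial, admissible quarter-turn-paired deflation, `0 ≤ Thi`, `beta ≤ 0`,
`Hhi/2 - rhohi² ≤ beta²`, `rhohi < beta`) and the residual-form block enclosures hold at `μ`, then
`min (g ρlo) (g ρhi) ≤ channelInf ε₀ μ 1 E ≤ ρhi` with `g ρ = (β ρ - ρ² - ẽ)/(β - ρ)`: `stub_klChannelBoundX` with the block's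
trial (reflection-even by `kl_bkbx_trialFun_refl`), shift `b.s` and deflation list (rotation invariant by
`kl_bkbx_deflKernel_rot`); the kernel is the plain `χ₀` since `ritzOK … E` forces `withU = false`.
[cite: ReedSimonIV1978, Thm. XIII.5] -/
theorem kl_bkbx_templeE {μ : ℝ} (hμ : μ ∈ Set.Ioo (-4 : ℝ) 0) (b : KLBlock) (tab : List KLTrig)
    (hT : b.templeOKX tab D4Irrep.E = true) (hE : b.EnclosureR tab μ D4Irrep.E) :
    min (((b.beta : ℝ) * (b.rholo : ℝ) - (b.rholo : ℝ) ^ 2 - (b.etil : ℝ)) / ((b.beta : ℝ) - (b.rholo : ℝ)))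
        (((b.beta : ℝ) * (b.rhohi : ℝ) - (b.rhohi : ℝ) ^ 2 - (b.etil : ℝ)) / ((b.beta : ℝ) - (b.rhohi : ℝ))) ≤
      channelInf (squareDispersion 1 0) μ 1 D4Irrep.E ∧
    channelInf (squareDispersion 1 0) μ 1 D4Irrep.E ≤ (b.rhohi : ℝ) := by
  have hT' := hT
  rw [KLBlock.templeOKX, if_pos rfl] at hT'
  simp only [Bool.and_eq_true, decide_eq_true_eq] at hT'
  obtain ⟨⟨⟨⟨⟨⟨⟨hritz, hdefl⟩, hpairs⟩, hcos⟩, hThi⟩, hβ0⟩, hHβ⟩, hρβ⟩ := hT'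
  obtain ⟨hut, hfits, hNlo, hQhi, hwu⟩ := kl_bkbx_ritz hritz
  have hW : b.withU = false := by
    cases hw : b.withU with
    | false => rfl
    | true => exact absurd (hwu hw) (by decide)
  obtain ⟨hE1, hE2⟩ := hE
  obtain ⟨h1, h2, h3, h4, h5⟩ := hE1 hut
  simp only [KLBlock.baseKernel, hW, Bool.false_eq_true, if_false, zero_add] at h3 h4 h5
  obtain ⟨hN, hρlo, hρhi, hρhi0, het⟩ :=
    kl_bkb_arith (by exact_mod_cast hNlo) (by exact_mod_cast hQhi) (by exact_mod_cast hThi) h1 h2 h3 h4 h5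
  have hrholo : ((b.rholo : ℚ) : ℝ) = min ((b.Qlo : ℝ) / (b.Nlo : ℝ)) ((b.Qlo : ℝ) / (b.Nhi : ℝ)) := by
    push_cast [KLBlock.rholo]; rfl
  have hrhohi : ((b.rhohi : ℚ) : ℝ) = max ((b.Qhi : ℝ) / (b.Nlo : ℝ)) ((b.Qhi : ℝ) / (b.Nhi : ℝ)) := by
    push_cast [KLBlock.rhohi]; rfl
  have hetil : ((b.etil : ℚ) : ℝ) = (b.Thi : ℝ) / (b.Nlo : ℝ) := by
    push_cast [KLBlock.etil]; rfl
  rw [← hrholo] at hρlo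
  rw [← hrhohi] at hρhi hρhi0
  rw [← hetil] at het
  have hH := hE2
  simp only [klS_sectorKernel_eq _ _ _ _ _ hW, kl_bkb_deflKernel_eq] at hH
  have hβ : (b.Hhi : ℝ) / 2 - (b.rhohi : ℝ) ^ 2 ≤ (b.beta : ℝ) ^ 2 := by
    have h := (Rat.cast_le (K := ℝ)).2 hHβ
    push_cast at h
    exact h
  exact stub_klChannelBoundX μ hμ b.defl.length (fun m => ((b.defl[(m : ℕ)].1 : ℚ) : ℝ))
    (fun m => (klTab tab b.defl[(m : ℕ)].2).toFun) (b.trialFun tab) (b.rholo : ℝ) (b.rhohi : ℝ) (b.etil : ℝ)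
    (b.Hhi : ℝ) (b.beta : ℝ) (b.s : ℝ) (kl_bkb_defl_nonneg hdefl) (fun m => kl_tr_toFun_memLp _ hμ)
    (kl_tr_toFun_memLp (klTab tab b.trial) hμ) (stub_klTrigChannel (klTab tab b.trial) _ hfits)
    (kl_bkbx_trialFun_refl b tab hcos) (kl_bkbx_deflKernel_rot b tab hpairs hdefl) hN hρlo hρhi hρhi0 het hH
    (by exact_mod_cast hβ0) hβ (by exact_mod_cast hρβ)

/-- **Temple/Ritz bounds of a block, `E_x` form**, all channels: for `χ ≠ E` the `E_x`-form Temple test is the residual-form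
one (`klX_templeOKX_of_ne`) and `kl_bkbr_temple` applies; for `χ = E` it is `kl_bkbx_templeE`. [folklore] -/
theorem kl_bkbx_temple {μ : ℝ} (hμ : μ ∈ Set.Ioo (-4 : ℝ) 0) (b : KLBlock) (tab : List KLTrig) (χ : D4Irrep)
    (hT : b.templeOKX tab χ = true) (hE : b.EnclosureR tab μ χ) :
    min (((b.beta : ℝ) * (b.rholo : ℝ) - (b.rholo : ℝ) ^ 2 - (b.etil : ℝ)) / ((b.beta : ℝ) - (b.rholo : ℝ)))
        (((b.beta : ℝ) * (b.rhohi : ℝ) - (b.rhohi : ℝ) ^ 2 - (b.etil : ℝ)) / ((b.beta : ℝ) - (b.rhohi : ℝ))) ≤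
      channelInf (squareDispersion 1 0) μ 1 χ ∧
    ((b.withU = true ∨ χ ≠ D4Irrep.A1g) → channelInf (squareDispersion 1 0) μ 1 χ ≤ (b.rhohi : ℝ)) := by
  by_cases hχ : χ = D4Irrep.E
  · subst hχ
    have h := kl_bkbx_templeE hμ b tab hT hE
    exact ⟨h.1, fun _ => h.2⟩
  · rw [klX_templeOKX_of_ne b tab χ hχ] at hT
    exact kl_bkbr_temple hμ b tab χ hT hE

/-! ### The stub -/

/-- **Block-level soundness of the checker's bounds, `E_x`-block form** (`stub_klBlockBoundsX`): for a block `b` with its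
residual-form enclosures at the level `μ ∈ (-4,0)` in the channel `χ`: if the `E_x`-form checker certifies a lower bound
(`lowerOKX`: `E_x`-form Temple data on a trial block, far-channel data on a block without trial) then
`b.lowerX tab χ ≤ channelInf ε₀ μ 1 χ` (`…ChannelBoundX` for `χ = E`, `…ChannelBoundR` for `χ ≠ E`, with the trial
`Φ = b.trialFun tab`, `ρlo = b.rholo`, `ρhi = b.rhohi`, `ẽ = b.etil`, `h = b.Hhi`, `β = b.beta`, shift `s = b.s` and the
deflation of the block; or `…ChannelFar` with `s = b.s` on a block without trial); if it accepts the `E_x`-form Temple data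
and the block is in the equality case (`withU ∨ χ ≠ A1g`) then `channelInf ε₀ μ 1 χ ≤ b.upper` (Ritz). [folklore] -/
theorem stub_klBlockBoundsX : ∀ μ ∈ Set.Ioo (-4 : ℝ) 0, ∀ (b : KLBlock) (tab : List KLTrig) (χ : D4Irrep),
    b.EnclosureR tab μ χ →
    (b.lowerOKX tab χ = true → ((b.lowerX tab χ : ℚ) : ℝ) ≤ channelInf (squareDispersion 1 0) μ 1 χ) ∧
    (b.templeOKX tab χ = true → (b.withU = true ∨ χ ≠ D4Irrep.A1g) →
      channelInf (squareDispersion 1 0) μ 1 χ ≤ ((b.upper : ℚ) : ℝ)) := by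
  intro μ hμ b tab χ hE
  refine ⟨fun hL => ?_, fun hT hcase => (kl_bkbx_temple hμ b tab χ hT hE).2 hcase⟩
  cases hut : b.useTrial with
  | true =>
    have hT : b.templeOKX tab χ = true := by simpa [KLBlock.lowerOKX, hut] using hL
    have h := (kl_bkbx_temple hμ b tab χ hT hE).1
    rw [KLBlock.lowerX, if_pos (by simp [hut, hT])]
    push_cast [KLBlock.templeR]
    exact h
  | false =>
    have hF : b.farOK tab χ = true := by simpa [KLBlock.lowerOKX, hut] using hL
    have hE' : b.Enclosure tab μ χ := ⟨fun h => absurd h (by simp [hut]), hE.2⟩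
    simp only [KLBlock.lowerX, hut, Bool.false_and, Bool.false_eq_true, ↓reduceIte]
    push_cast
    exact kl_bkb_far hμ b tab χ hF hE'

end Summit.HubbardSuperconductivity.HubbardSuperconductivity.Theorems

end
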